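import Summits.CriticalPhenomena.PercolationContinuityZ3.Theorems.PercNearOneGluingAdditiveGluingUncenteredTransfer
import Literature.Probability.Percolation.TwoClusterExchange
import HarnessLib

/-!
# Crux `PercNearOneGluing.AdditiveGluing` (stmt-CriticalPhenomena-4576), line `tieline`: the SHARP transfer rate

Support file (`--supports stmt-CriticalPhenomena-4576`, helper, seat (d) exchange-certificate form, gen 9).  No definitions,
no named facts, no sorries.

The registered kernel (T) = `stub_k0CovTransferQ_c9` at roles `(o,b,u,v,c)` reads `μ(N)·X_o ≥ μ(N ∩ {o↔c})·X_c` with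
`D = {u↮v}`, `N = {c↮u} ∩ {c↮v}`, `X_x = μ(D∩{u↔b})μ(D∩{v↔x}) − μ(D)μ(D∩{u↔b}∩{v↔x})` (rate `θ₀ = μ(o↔c | N)`).
The census of EXCHCERT-g9 §12 (0 violations in 9 925 272 exact role-instances on all multigraphs with ≤ 7 vertices, ttrl2
fibre/TSHARP.md; tight exactly on the separator locus) suggests the SHARP FORM (T♯): the same inequality with `N` replaced by
`Z = N ∩ {u↮v} ∩ {u↮b} ∩ {v↮b}`, i.e. with the larger rate `θ♯ = μ(o↔c | c↮u, c↮v, u↮v, u↮b, v↮b)`.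
This file proves the two facts that make (T♯) a legitimate replacement target:
* `sharpRate_ge` — **the rate is monotone**: `μ(N ∩ {o↔c})·μ(Z) ≤ μ(Z ∩ {o↔c})·μ(N)` (θ₀ ≤ θ♯).  Proof: given `c ↮ {u,v}` the
  cluster of `c` is positively associated (van den Berg–Häggström–Kahn, Thm. 1.3 with `X = {u,v}`), and both `W ↦ 1{o ∈ V(W)}` and
  `W ↦ P(u↮v, u↮b, v↮b off W̄)` are increasing functions of the cluster `W = C_c` (the second by BHK's display (10): given `C_c = W`
  the configuration off `W̄` is a fresh percolation, and deleting more edges only helps non-connection);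
* `covTransferQ_of_sharp` — **(T♯) ⟹ (T) pointwise** whenever `μ(Z) > 0`, using `X_c ≥ 0` (BHK Thm. 1.5, `twoClusterExchange`).
[cite: VandenbergHaggstromKahn2005, Thm. 1.3 (p. 6), Thm. 1.5 (p. 7), display (10) (pp. 7–8) — corollaries]
-/

namespace Summit.CriticalPhenomena.PercolationContinuityZ3.Cruxes.AdditiveGluing.TieLine

open MeasureTheory Set
open Literature.Probability.LatticeModels (prodBernoulli)
open Literature.Probability.Percolation
open Literature.Probability.Percolation.BHK2006
open Literature.Probability.Percolation.DecisionTree (ind ind_of_mem ind_of_not_mem ind_nonneg)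

noncomputable section
open scoped Classical

local notation3 (prettyPrint := false) "D⟦" s ", " X "⟧" => {ω | ∀ x ∈ X, ¬ (openGraph ω).Reachable s x}
local notation3 (prettyPrint := false) "B⟦" W ", " s "⟧" => {e | ∃ v ∈ e, v = s ∨ ∃ e' ∈ W, v ∈ e'}

namespace SharpTransfer

open UncenteredTransfer

variable {V : Type*} [Fintype V] (w : Sym2 V → unitInterval)

/-- Deleting edges preserves non-connection: the triple non-connection indicator is antitone in the edge set. [folklore] -/
theorem tri_anti {E E' : Set (Sym2 V)} (h : E ⊆ E') (u v b : V) :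
    (if ¬ (openGraph E').Reachable u v ∧ ¬ (openGraph E').Reachable u b ∧ ¬ (openGraph E').Reachable v b
      then (1 : ℝ) else 0) ≤
    (if ¬ (openGraph E).Reachable u v ∧ ¬ (openGraph E).Reachable u b ∧ ¬ (openGraph E).Reachable v b
      then (1 : ℝ) else 0) := by
  by_cases h' : ¬ (openGraph E').Reachable u v ∧ ¬ (openGraph E').Reachable u b ∧ ¬ (openGraph E').Reachable v b
  · rw [if_pos h', if_pos ⟨fun hr => h'.1 (reach_mono h hr), fun hr => h'.2.1 (reach_mono h hr),
      fun hr => h'.2.2 (reach_mono h hr)⟩]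
  · rw [if_neg h']; split_ifs <;> norm_num

/-- `W ↦ P(u↮v, u↮b, v↮b off W̄)` (with `W̄ = B⟦W,c⟧`) is increasing in the cluster `W`. [cite: VandenbergHaggstromKahn2005, §1 p. 8] -/
theorem offTri_mono (c u v b : V) :
    Monotone fun W : Set (Sym2 V) => ∑ η : Set (Sym2 V), weight (fun e => (w e : ℝ)) η *
      (if ¬ (openGraph (η \ B⟦W, c⟧)).Reachable u v ∧ ¬ (openGraph (η \ B⟦W, c⟧)).Reachable u b ∧
          ¬ (openGraph (η \ B⟦W, c⟧)).Reachable v b then (1 : ℝ) else 0) := by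
  intro W W' hWW'
  refine Finset.sum_le_sum fun η _ => mul_le_mul_of_nonneg_left ?_ (weight_nonneg (wr_nonneg w) (wr_le_one w) η)
  exact tri_anti (Set.sdiff_subset_sdiff_right (bar_mono c hWW')) u v b

omit [Fintype V] in
/-- `ω ∈ D⟦c,{u,v}⟧ ↔ c ↮ u ∧ c ↮ v`. [folklore] -/
theorem mem_D_pair (ω : BondConfig V) (c u v : V) :
    ω ∈ D⟦c, ({u, v} : Set V)⟧ ↔ ¬ (openGraph ω).Reachable c u ∧ ¬ (openGraph ω).Reachable c v := by
  simp only [Set.mem_setOf_eq, Set.mem_insert_iff, Set.mem_singleton_iff, forall_eq_or_imp, forall_eq]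

/-- **Display (10) for the triple non-connection weight.**  For `D = {c ↮ u, c ↮ v}` and a predicate `R` of the cluster `C_c`:
`μ(D ∩ {R(C_c)} ∩ {u↮v} ∩ {u↮b} ∩ {v↮b}) = Σ_ω weight(ω) 1_D 1{R} · P(u↮v, u↮b, v↮b off C̄_c(ω))` — on `D` a connection
between `u, v, b` cannot pass through `C_c`, so it is a connection off `C̄_c`; then block Fubini on `{C_c = W}`.
[cite: VandenbergHaggstromKahn2005, §1 pp. 7–8, (10)] -/
theorem real_tri_eq_sum (c u v b : V) (R : Set (Sym2 V) → Prop) :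
    (prodBernoulli w).real (D⟦c, ({u, v} : Set V)⟧ ∩ {ω | R (openEdgeCluster ω c)} ∩ (openConn u v)ᶜ ∩ (openConn u b)ᶜ ∩
        (openConn v b)ᶜ) =
      ∑ ω : Set (Sym2 V), weight (fun e => (w e : ℝ)) ω *
        ((∑ η : Set (Sym2 V), weight (fun e => (w e : ℝ)) η *
            ((if R (openEdgeCluster ω c) then (1 : ℝ) else 0) *
              (if ¬ (openGraph (η \ B⟦openEdgeCluster ω c, c⟧)).Reachable u v ∧
                  ¬ (openGraph (η \ B⟦openEdgeCluster ω c, c⟧)).Reachable u b ∧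
                  ¬ (openGraph (η \ B⟦openEdgeCluster ω c, c⟧)).Reachable v b then (1 : ℝ) else 0))) *
          ind D⟦c, ({u, v} : Set V)⟧ ω) := by
  have hD : ∀ ω : Set (Sym2 V), ω ∈ D⟦c, ({u, v} : Set V)⟧ ↔ ∀ x ∈ ({u, v} : Set V), ¬ (openGraph ω).Reachable c x :=
    fun ω => Iff.rfl
  have key := OffCluster.sum_cond_cluster_off_ind (fun e => (w e : ℝ)) (sum_weight w) c ({u, v} : Set V)
    (fun C E => (if R C then (1 : ℝ) else 0) *
      (if ¬ (openGraph E).Reachable u v ∧ ¬ (openGraph E).Reachable u b ∧ ¬ (openGraph E).Reachable v b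
        then (1 : ℝ) else 0)) hD
  rw [real_eq_sum]
  have hpt : ∀ ω : Set (Sym2 V), weight (fun e => (w e : ℝ)) ω *
      ind (D⟦c, ({u, v} : Set V)⟧ ∩ {ω | R (openEdgeCluster ω c)} ∩ (openConn u v)ᶜ ∩ (openConn u b)ᶜ ∩ (openConn v b)ᶜ) ω =
      weight (fun e => (w e : ℝ)) ω * ((if R (openEdgeCluster ω c) then (1 : ℝ) else 0) *
        (if ¬ (openGraph (ω \ B⟦openEdgeCluster ω c, c⟧)).Reachable u v ∧
            ¬ (openGraph (ω \ B⟦openEdgeCluster ω c, c⟧)).Reachable u b ∧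
            ¬ (openGraph (ω \ B⟦openEdgeCluster ω c, c⟧)).Reachable v b then (1 : ℝ) else 0) *
        ind D⟦c, ({u, v} : Set V)⟧ ω) := by
    intro ω
    by_cases hDω : ω ∈ D⟦c, ({u, v} : Set V)⟧
    · have huc : ¬ (openGraph ω).Reachable u c := fun h => ((mem_D_pair ω c u v).1 hDω).1 h.symm
      have hvc : ¬ (openGraph ω).Reachable v c := fun h => ((mem_D_pair ω c u v).1 hDω).2 h.symm
      rw [UncenteredTransfer.ind_inter, UncenteredTransfer.ind_inter, UncenteredTransfer.ind_inter, UncenteredTransfer.ind_inter,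
        ind_of_mem hDω]
      have h1 : ind {ω : Set (Sym2 V) | R (openEdgeCluster ω c)} ω = if R (openEdgeCluster ω c) then (1 : ℝ) else 0 :=
        ind_setOf_eq R ω
      have h2 : ind ((openConn u v)ᶜ : Set (BondConfig V)) ω * ind ((openConn u b)ᶜ : Set (BondConfig V)) ω *
          ind ((openConn v b)ᶜ : Set (BondConfig V)) ω =
          if ¬ (openGraph (ω \ B⟦openEdgeCluster ω c, c⟧)).Reachable u v ∧
              ¬ (openGraph (ω \ B⟦openEdgeCluster ω c, c⟧)).Reachable u b ∧
              ¬ (openGraph (ω \ B⟦openEdgeCluster ω c, c⟧)).Reachable v b then (1 : ℝ) else 0 := by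
        have euv := OffCluster.reachable_off_iff huc v
        have eub := OffCluster.reachable_off_iff huc b
        have evb := OffCluster.reachable_off_iff hvc b
        by_cases a1 : (openGraph ω).Reachable u v
        · rw [ind_of_not_mem (show ω ∉ ((openConn u v)ᶜ : Set (BondConfig V)) from fun h => h a1)]
          rw [if_neg (fun h => h.1 (euv.1 a1))]; ring
        rw [ind_of_mem (show ω ∈ ((openConn u v)ᶜ : Set (BondConfig V)) from a1)]
        by_cases a2 : (openGraph ω).Reachable u b
        · rw [ind_of_not_mem (show ω ∉ ((openConn u b)ᶜ : Set (BondConfig V)) from fun h => h a2)]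
          rw [if_neg (fun h => h.2.1 (eub.1 a2))]; ring
        rw [ind_of_mem (show ω ∈ ((openConn u b)ᶜ : Set (BondConfig V)) from a2)]
        by_cases a3 : (openGraph ω).Reachable v b
        · rw [ind_of_not_mem (show ω ∉ ((openConn v b)ᶜ : Set (BondConfig V)) from fun h => h a3)]
          rw [if_neg (fun h => h.2.2 (evb.1 a3))]; ring
        rw [ind_of_mem (show ω ∈ ((openConn v b)ᶜ : Set (BondConfig V)) from a3)]
        rw [if_pos ⟨fun h => a1 (euv.2 h), fun h => a2 (eub.2 h), fun h => a3 (evb.2 h)⟩]; ring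
      rw [h1, ← h2]; ring
    · rw [ind_of_not_mem (fun h => hDω h.1.1.1.1), ind_of_not_mem hDω]; ring
  rw [Finset.sum_congr rfl fun ω _ => hpt ω, key]

omit [Fintype V] in
/-- `{c ↮ u, c ↮ v}` as the avoidance event `D⟦c,{u,v}⟧`. [folklore] -/
theorem setId_N2 (c u v : V) :
    D⟦c, ({u, v} : Set V)⟧ = ((openConn c u)ᶜ ∩ (openConn c v)ᶜ : Set (BondConfig V)) := by
  ext ω; rw [mem_D_pair]; rfl

omit [Fintype V] in
/-- `{c ↮ u, c ↮ v} ∩ {o ∈ V(C_c)} = {c↮u} ∩ {c↮v} ∩ {o ↔ c}`. [folklore] -/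
theorem setId_N2_O (c u v o : V) :
    D⟦c, ({u, v} : Set V)⟧ ∩ {ω | o = c ∨ ∃ e ∈ openEdgeCluster ω c, o ∈ e} =
      ((openConn c u)ᶜ ∩ (openConn c v)ᶜ ∩ openConn o c : Set (BondConfig V)) := by
  ext ω
  simp only [Set.mem_inter_iff, Set.mem_setOf_eq, Set.mem_insert_iff, Set.mem_singleton_iff, forall_eq_or_imp, forall_eq,
    memV_iff, Set.mem_compl_iff, openConn]
  constructor
  · rintro ⟨⟨h1, h2⟩, h3⟩; exact ⟨⟨h1, h2⟩, h3.symm⟩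
  · rintro ⟨⟨h1, h2⟩, h3⟩; exact ⟨⟨h1, h2⟩, h3.symm⟩

/-- **The sharp rate dominates the plain rate (θ₀ ≤ θ♯).**  With `N = {c↮u} ∩ {c↮v}` and
`Z = N ∩ {u↮v} ∩ {u↮b} ∩ {v↮b}`:  `μ(N ∩ {o↔c}) · μ(Z) ≤ μ(Z ∩ {o↔c}) · μ(N)` — positive association of the cluster of `c`
given `c ↮ {u,v}` (BHK Thm. 1.3, `X = {u,v}`) for the increasing functions `1{o ∈ V(C_c)}` and `P(u↮v, u↮b, v↮b off C̄_c)`.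
[cite: VandenbergHaggstromKahn2005, Thm. 1.3 (p. 6), display (10) (pp. 7–8) — corollary] -/
theorem sharpRate_ge (u v o c b : V) (hcu : c ≠ u) (hcv : c ≠ v) :
    (prodBernoulli w).real ((openConn c u)ᶜ ∩ (openConn c v)ᶜ ∩ openConn o c) *
        (prodBernoulli w).real ((openConn c u)ᶜ ∩ (openConn c v)ᶜ ∩ (openConn u v)ᶜ ∩ (openConn u b)ᶜ ∩ (openConn v b)ᶜ) ≤
      (prodBernoulli w).real ((openConn c u)ᶜ ∩ (openConn c v)ᶜ ∩ (openConn u v)ᶜ ∩ (openConn u b)ᶜ ∩ (openConn v b)ᶜ ∩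
          openConn o c) *
        (prodBernoulli w).real ((openConn c u)ᶜ ∩ (openConn c v)ᶜ : Set (BondConfig V)) := by
  set S : Set (Sym2 V) → ℝ := fun W => ∑ η : Set (Sym2 V), weight (fun e => (w e : ℝ)) η *
    (if ¬ (openGraph (η \ B⟦W, c⟧)).Reachable u v ∧ ¬ (openGraph (η \ B⟦W, c⟧)).Reachable u b ∧
        ¬ (openGraph (η \ B⟦W, c⟧)).Reachable v b then (1 : ℝ) else 0) with hS
  set Φ₁ : Set (Sym2 V) → ℝ := fun W => if (o = c ∨ ∃ e ∈ W, o ∈ e) then (1 : ℝ) else 0 with hΦ₁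
  have hmemV_mono : ∀ ⦃W W' : Set (Sym2 V)⦄, W ⊆ W' → (o = c ∨ ∃ e ∈ W, o ∈ e) → (o = c ∨ ∃ e ∈ W', o ∈ e) := by
    rintro W W' h (hx | ⟨e, he, hxe⟩)
    exacts [Or.inl hx, Or.inr ⟨e, h he, hxe⟩]
  have hΦ₁m : Monotone Φ₁ := by
    intro W W' hWW'
    simp only [hΦ₁]
    by_cases hW : (o = c ∨ ∃ e ∈ W, o ∈ e)
    · rw [if_pos hW, if_pos (hmemV_mono hWW' hW)]
    · rw [if_neg hW]; split_ifs <;> norm_num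
  have hSm : Monotone S := offTri_mono w c u v b
  have hcX : c ∉ ({u, v} : Set V) := by
    simp only [Set.mem_insert_iff, Set.mem_singleton_iff, not_or]; exact ⟨hcu, hcv⟩
  have h13 := BHK2006_clusterConditionalPositiveAssociation_holds V w c ({u, v} : Set V) Φ₁ S hΦ₁m hSm hcX
  -- identify the integrals
  have e1 : ∫ ω in D⟦c, ({u, v} : Set V)⟧, Φ₁ (openEdgeCluster ω c) ∂(prodBernoulli w) =
      (prodBernoulli w).real ((openConn c u)ᶜ ∩ (openConn c v)ᶜ ∩ openConn o c) := by
    simp only [hΦ₁]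
    rw [OffCluster.setIntegral_ite_eq]
    exact congrArg _ (setId_N2_O c u v o)
  have e2 : ∫ ω in D⟦c, ({u, v} : Set V)⟧, S (openEdgeCluster ω c) ∂(prodBernoulli w) =
      (prodBernoulli w).real ((openConn c u)ᶜ ∩ (openConn c v)ᶜ ∩ (openConn u v)ᶜ ∩ (openConn u b)ᶜ ∩ (openConn v b)ᶜ) := by
    have h := real_tri_eq_sum w c u v b (fun _ => True)
    rw [show (D⟦c, ({u, v} : Set V)⟧ ∩ {ω | (fun _ => True) (openEdgeCluster ω c)}) = D⟦c, ({u, v} : Set V)⟧ from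
      Set.inter_univ _ |>.symm ▸ (by ext ω; simp), setId_N2] at h
    rw [h, setIntegral_eq_sum]
    refine Finset.sum_congr rfl fun ω _ => ?_
    rw [setId_N2]
    simp only [hS, if_true, one_mul]
  have e3 : ∫ ω in D⟦c, ({u, v} : Set V)⟧, Φ₁ (openEdgeCluster ω c) * S (openEdgeCluster ω c) ∂(prodBernoulli w) =
      (prodBernoulli w).real ((openConn c u)ᶜ ∩ (openConn c v)ᶜ ∩ (openConn u v)ᶜ ∩ (openConn u b)ᶜ ∩ (openConn v b)ᶜ ∩
        openConn o c) := by
    have h := real_tri_eq_sum w c u v b (fun W => o = c ∨ ∃ e ∈ W, o ∈ e)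
    rw [setId_N2_O] at h
    rw [show ((openConn c u)ᶜ ∩ (openConn c v)ᶜ ∩ (openConn u v)ᶜ ∩ (openConn u b)ᶜ ∩ (openConn v b)ᶜ ∩ openConn o c :
        Set (BondConfig V)) = (openConn c u)ᶜ ∩ (openConn c v)ᶜ ∩ openConn o c ∩ (openConn u v)ᶜ ∩ (openConn u b)ᶜ ∩
        (openConn v b)ᶜ by ext ω; simp only [Set.mem_inter_iff]; tauto, h, setIntegral_eq_sum]
    refine Finset.sum_congr rfl fun ω _ => ?_
    rw [setId_N2]
    by_cases hO : (o = c ∨ ∃ e ∈ openEdgeCluster ω c, o ∈ e)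
    · simp only [hΦ₁, hS, hO, if_true, one_mul]
    · simp [hΦ₁, hO]
  rw [e1, e2, e3, setId_N2] at h13
  linarith [h13]

/-- **(T♯) ⟹ (T), pointwise.**  At fixed roles with `c ≠ u`, `c ≠ v`, `u ≠ v` and `μ(Z) > 0`, the sharp transfer inequality
(rate conditioned on `Z = {c↮u,c↮v,u↮v,u↮b,v↮b}`) implies the registered one (rate conditioned on `N = {c↮u,c↮v}`), because
`θ₀ ≤ θ♯` (`sharpRate_ge`) and `X_c = μ(D∩ub)μ(D∩vc) − μ(D)μ(D∩ub∩vc) ≥ 0` (BHK Thm. 1.5, `twoClusterExchange`).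
[cite: VandenbergHaggstromKahn2005, Thm. 1.3 (p. 6), Thm. 1.5 (p. 7) — corollary] -/
theorem covTransferQ_of_sharp (u v o c b : V) (hcu : c ≠ u) (hcv : c ≠ v) (huv : u ≠ v)
    (hZ : 0 < (prodBernoulli w).real ((openConn c u)ᶜ ∩ (openConn c v)ᶜ ∩ (openConn u v)ᶜ ∩ (openConn u b)ᶜ ∩
      (openConn v b)ᶜ))
    (hsharp : (prodBernoulli w).real ((openConn u v)ᶜ : Set (BondConfig V)) *
        ((prodBernoulli w).real ((openConn u v)ᶜ ∩ openConn u b ∩ openConn v o) *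
            (prodBernoulli w).real ((openConn c u)ᶜ ∩ (openConn c v)ᶜ ∩ (openConn u v)ᶜ ∩ (openConn u b)ᶜ ∩ (openConn v b)ᶜ) -
          (prodBernoulli w).real ((openConn u v)ᶜ ∩ openConn u b ∩ openConn v c) *
            (prodBernoulli w).real ((openConn c u)ᶜ ∩ (openConn c v)ᶜ ∩ (openConn u v)ᶜ ∩ (openConn u b)ᶜ ∩ (openConn v b)ᶜ ∩
              openConn o c)) ≤
      (prodBernoulli w).real ((openConn u v)ᶜ ∩ openConn u b) *
        ((prodBernoulli w).real ((openConn u v)ᶜ ∩ openConn v o) *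
            (prodBernoulli w).real ((openConn c u)ᶜ ∩ (openConn c v)ᶜ ∩ (openConn u v)ᶜ ∩ (openConn u b)ᶜ ∩ (openConn v b)ᶜ) -
          (prodBernoulli w).real ((openConn u v)ᶜ ∩ openConn v c) *
            (prodBernoulli w).real ((openConn c u)ᶜ ∩ (openConn c v)ᶜ ∩ (openConn u v)ᶜ ∩ (openConn u b)ᶜ ∩ (openConn v b)ᶜ ∩
              openConn o c))) :
    (prodBernoulli w).real ((openConn u v)ᶜ : Set (BondConfig V)) *
        ((prodBernoulli w).real ((openConn u v)ᶜ ∩ openConn u b ∩ openConn v o) *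
            (prodBernoulli w).real ((openConn c u)ᶜ ∩ (openConn c v)ᶜ : Set (BondConfig V)) -
          (prodBernoulli w).real ((openConn u v)ᶜ ∩ openConn u b ∩ openConn v c) *
            (prodBernoulli w).real ((openConn c u)ᶜ ∩ (openConn c v)ᶜ ∩ openConn o c)) ≤
      (prodBernoulli w).real ((openConn u v)ᶜ ∩ openConn u b) *
        ((prodBernoulli w).real ((openConn u v)ᶜ ∩ openConn v o) *
            (prodBernoulli w).real ((openConn c u)ᶜ ∩ (openConn c v)ᶜ : Set (BondConfig V)) -
          (prodBernoulli w).real ((openConn u v)ᶜ ∩ openConn v c) *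
            (prodBernoulli w).real ((openConn c u)ᶜ ∩ (openConn c v)ᶜ ∩ openConn o c)) := by
  -- names
  set A := (prodBernoulli w).real ((openConn u v)ᶜ : Set (BondConfig V)) with hA
  set B := (prodBernoulli w).real ((openConn u v)ᶜ ∩ openConn u b ∩ openConn v o) with hB
  set C := (prodBernoulli w).real ((openConn u v)ᶜ ∩ openConn u b ∩ openConn v c) with hC
  set E := (prodBernoulli w).real ((openConn u v)ᶜ ∩ openConn u b) with hE
  set F := (prodBernoulli w).real ((openConn u v)ᶜ ∩ openConn v o) with hF
  set G := (prodBernoulli w).real ((openConn u v)ᶜ ∩ openConn v c) with hG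
  set n := (prodBernoulli w).real ((openConn c u)ᶜ ∩ (openConn c v)ᶜ : Set (BondConfig V)) with hn
  set noc := (prodBernoulli w).real ((openConn c u)ᶜ ∩ (openConn c v)ᶜ ∩ openConn o c) with hnoc
  set z := (prodBernoulli w).real ((openConn c u)ᶜ ∩ (openConn c v)ᶜ ∩ (openConn u v)ᶜ ∩ (openConn u b)ᶜ ∩ (openConn v b)ᶜ)
    with hz
  set zoc := (prodBernoulli w).real ((openConn c u)ᶜ ∩ (openConn c v)ᶜ ∩ (openConn u v)ᶜ ∩ (openConn u b)ᶜ ∩ (openConn v b)ᶜ ∩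
    openConn o c) with hzoc
  -- θ₀ ≤ θ♯
  have hrate : noc * z ≤ zoc * n := sharpRate_ge w u v o c b hcu hcv
  -- X_c ≥ 0 : BHK Thm 1.5 for `A₁ = {u↔b}` (type +), `B₁ = {v↔c}` (type −), `A₂ = B₂ = univ`
  have hXc : A * C ≤ E * G := by
    have h := twoClusterExchange w huv (A₁ := (openConn u b : Set (BondConfig V))) (A₂ := Set.univ)
      (B₁ := (openConn v c : Set (BondConfig V))) (B₂ := Set.univ)
      (typePlus_openConn u v b) (fun _ _ _ _ _ => Set.mem_univ _) (typeMinus_openConn u v c) (fun _ _ _ _ _ => Set.mem_univ _)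
    rw [Set.univ_inter, Set.inter_univ, Set.inter_univ, Set.inter_univ, ← Set.inter_assoc] at h
    rw [hA, hC, hE, hG, mul_comm]
    exact h
  have hn0 : 0 ≤ n := measureReal_nonneg
  -- (T♯) says  z·(EF − AB) ≥ zoc·(EG − AC)
  have hs : zoc * (E * G - A * C) ≤ z * (E * F - A * B) := by linarith [hsharp]
  -- multiply the goal by z > 0
  have key : z * (noc * (E * G - A * C)) ≤ z * (n * (E * F - A * B)) := by
    have h1 : noc * (E * G - A * C) * z ≤ zoc * n * (E * G - A * C) := by nlinarith [hrate, hXc]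
    nlinarith [hs, hn0, hXc, h1]
  have := le_of_mul_le_mul_left key hZ
  linarith [this]

end SharpTransfer

end

end Summit.CriticalPhenomena.PercolationContinuityZ3.Cruxes.AdditiveGluing.TieLine
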